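import Summits.QuantumFields.YangMills.Theses.SqueezedSkewness
import Summits.QuantumFields.YangMills.Theorems.SqueezedSkewnessCollarBumpCross
import Summits.QuantumFields.YangMills.Theorems.SqueezedSkewnessCollarBumpTwoPoint
import Summits.QuantumFields.YangMills.Theorems.ThermalDescentTransportIdentity
import Summits.QuantumFields.YangMills.Theorems.LangevinControlUVOSLegsAtWeakCouplingCFblOfFbl6
import HarnessLib

/-!
# Route `SqueezedSkewness`, support `CollarBumpFloors` (stmt-QuantumFields-23680, LINE χ₂ «femto currency») — BY NAME

In ANY unit `(r, a)` (`0 < a(β) → 0`) carrying the spine's plane-resolved femto boundary law `FBL6 G r a` and its conditional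
two-point sandwich `FC2 G r a`, the reflection form of the route has femto-window floors for bumps of every radius: for every
`ρ > 0` a bump `v ≥ 0` inside `closedBall(e₀, ρ)` and a slab, a femto height `h₁` (`3h₁ ≤ δ₁`) and `ε > 0` such that every translate
`f = v(· + τ e₀)` with lower edge `δ₁ − τ ∈ [h₁, 3h₁]` has `ε ≤ Qrp_{(2L+1)⁴}(β, a(β), f)` for `β ≥ β₅`, `a(β)L ≥ Λ₅`.

Proof (fleet lead `ym-spine-19353-p1` g20):
* `Qrp(f) = Q2(θf, f) − Cov_P(D_f ∘ refl, B_f)` — the LANDED `ThermalDescent.TransportIdentity` (same let-block as this route);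
* `Q2(θf, f) ≥ 3ε` uniformly over the window — `CollarBumpTwoPoint.twoPoint_floor_window` (the spine's per-pair floor from
  `FBL` (`fbl_of_fbl6`) and `FC2` at the pair scale `2(1 − τ)`, plateau Riemann masses);
* `|Cov_P(D_f ∘ refl, B_f)| ≤ 18 (C/R⁴)² · Σ|df| · Σ|f| ≤ M·a(β) ≤ ε` — `CollarBumpCross.abs_cross_le` with the collar output
  `MomentBounds6` (landed `stub_collar6` on `FBL6`) at `R = ⌊c₀/a⌋`, `c₀ = min(h₁/4, ℓ₄)`, the translate-uniform weight sums
  `Σ|df| ≤ K₁(1+|τ|)⁸4⁴/a³` (`sum_abs_sub_translate_le`) and `Σ|f| ≤ K₀(1+|τ|)⁸4⁴/a⁴` (`FemtoCeilingProof.sum_abs_translate_le`).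
Thresholds: `a(β) ≤ min(c₀/2, h₁/4, 1, ε/(M+1))`, `β ≥ max(β₅, β₄, 0)`, `a(β)L ≥ max(Λ₅, 4c₀ + 8, 2(|δ₂| + |δ₁| + 3h₁) + 1)`.
(`maxHeartbeats 400000` on the main theorem only: the route's reflection form `Qrp` is a large explicit term.)

HONEST FRAMING: a CONDITIONAL floor — `FBL6` and `FC2` (the spine's femto two-point package, crux `FemtoTwoPointUnit` 23679, XL) are
hypotheses and are NOT proved; no NT statement (stmt-QuantumFields-19353), rung of record or mass gap follows. [folklore]
-/

set_option autoImplicit false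

noncomputable section

open scoped SchwartzMap
open MeasureTheory Filter Topology Metric
open Literature.MathematicalPhysics.QuantumFieldTheory Literature.MathematicalPhysics.QuantumLattice
open Literature.Probability.LatticeModels (box)
open Summit.QuantumFields.YangMills.Cruxes.OSLegsFromFemtoAndGap.DlrCollarTransfer
open Summit.QuantumFields.YangMills.Theorems.ThermalDescentTorusDictionary (eF aF zOf sum_box_eq_sum_fin)
open Summit.QuantumFields.YangMills.Theorems.ThermalDescentCornerCov (posZ)
open Summit.QuantumFields.YangMills.Theorems.ThermalDescentSeamFromMoments (posZ_eq_siteToE_zOf exists_abs_sub_le_decay)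
open Summit.QuantumFields.YangMills.Theorems.FemtoCeilingProof (inv_bracket_add_le exists_abs_le_decay sum_abs_translate_le)
open Summit.QuantumFields.YangMills.Cruxes.UniversalDetectorLimitExtraction (latticeRiemannBound)
open Summit.QuantumFields.YangMills.Cruxes.NT.Reference (eventually_le_of_tendsto div_pow_depth_le)
open Summit.QuantumFields.YangMills.Theorems.CollarBumpCross (abs_cross_le)
open Summit.QuantumFields.YangMills.Theorems.CollarBumpTwoPoint (twoPoint_floor_window tsupport_translate_subset)

namespace Summit.QuantumFields.YangMills.Theorems.CollarBumpFloorsProof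

/-! ## §1 The translate-uniform sum of the time differences -/

/-- **Uniform translated lattice bound for the time differences of a Schwartz weight**: for `0 < s ≤ 1`,
`Σ_u |v(s u + s e₀ + w) − v(s u + w)| ≤ K_v (1 + ‖w‖)⁸ 4⁴ / s³` on every odd torus (mean value + Schwartz decay of `∂v`, a bracket
shift by `w`, the tree's uniform lattice Riemann bound). [folklore] -/
theorem sum_abs_sub_translate_le {v : 𝓢(EuclideanSpace ℝ (Fin 4), ℝ)} {K : ℝ} (hK0 : 0 ≤ K)
    (hK : ∀ (z e : EuclideanSpace ℝ (Fin 4)), ‖e‖ ≤ 1 → |v (z + e) - v z| ≤ K * ‖e‖ * ((1 + ‖z‖) ^ 8)⁻¹)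
    (L : ℕ) {s : ℝ} (hs : 0 < s) (hs1 : s ≤ 1) (w : EuclideanSpace ℝ (Fin 4)) :
    ∑ u : FinTorusSite (2 * L + 1) (2 * L + 1) (2 * L + 1) (2 * L + 1),
        |v (s • posZ (2 * L + 1) u + s • EuclideanSpace.single (0 : Fin 4) (1 : ℝ) + w) - v (s • posZ (2 * L + 1) u + w)| ≤
      K * (1 + ‖w‖) ^ 8 * 4 ^ 4 / s ^ 3 := by
  have he : ‖s • EuclideanSpace.single (0 : Fin 4) (1 : ℝ)‖ = s := by
    rw [norm_smul, PiLp.norm_single, norm_one, mul_one, Real.norm_of_nonneg hs.le]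
  have hpt : ∀ u : FinTorusSite (2 * L + 1) (2 * L + 1) (2 * L + 1) (2 * L + 1),
      |v (s • posZ (2 * L + 1) u + s • EuclideanSpace.single (0 : Fin 4) (1 : ℝ) + w) - v (s • posZ (2 * L + 1) u + w)| ≤
        K * s * (1 + ‖w‖) ^ 8 * ((1 + ‖s • siteToE (zOf (2 * L + 1) u)‖) ^ (2 * 4))⁻¹ := by
    intro u
    have h := hK (s • posZ (2 * L + 1) u + w) (s • EuclideanSpace.single (0 : Fin 4) (1 : ℝ)) (by rw [he]; exact hs1)
    rw [he, add_right_comm] at h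
    refine h.trans ?_
    rw [posZ_eq_siteToE_zOf, show (2 * 4 : ℕ) = 8 by norm_num, mul_assoc (K * s)]
    exact mul_le_mul_of_nonneg_left (inv_bracket_add_le _ _) (by positivity)
  have hRB := latticeRiemannBound 4 L hs hs1
  have hs4 : 0 < s ^ 4 := by positivity
  have hsum : ∑ x ∈ box 4 L, ((1 + ‖s • siteToE x‖) ^ (2 * 4))⁻¹ ≤ 4 ^ 4 / s ^ 4 := by
    rw [le_div_iff₀ hs4, mul_comm]; exact hRB
  calc ∑ u : FinTorusSite (2 * L + 1) (2 * L + 1) (2 * L + 1) (2 * L + 1),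
        |v (s • posZ (2 * L + 1) u + s • EuclideanSpace.single (0 : Fin 4) (1 : ℝ) + w) - v (s • posZ (2 * L + 1) u + w)|
      ≤ ∑ u : FinTorusSite (2 * L + 1) (2 * L + 1) (2 * L + 1) (2 * L + 1),
          K * s * (1 + ‖w‖) ^ 8 * ((1 + ‖s • siteToE (zOf (2 * L + 1) u)‖) ^ (2 * 4))⁻¹ := Finset.sum_le_sum fun u _ => hpt u
    _ = K * s * (1 + ‖w‖) ^ 8 * ∑ x ∈ box 4 L, ((1 + ‖s • siteToE x‖) ^ (2 * 4))⁻¹ := by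
        rw [Finset.mul_sum, sum_box_eq_sum_fin]
    _ ≤ K * s * (1 + ‖w‖) ^ 8 * (4 ^ 4 / s ^ 4) := mul_le_mul_of_nonneg_left hsum (by positivity)
    _ = K * (1 + ‖w‖) ^ 8 * 4 ^ 4 / s ^ 3 := by field_simp

/-! ## §2 Arithmetic of the assembly -/

/-- `Q = P + X`, `3ε ≤ Q`, `|X| ≤ ε` give `ε ≤ P`. [folklore] -/
theorem le_of_split {Q P X ε : ℝ} (hQ : Q = P + X) (hε : 3 * ε ≤ Q) (hX : |X| ≤ ε) : ε ≤ P := by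
  have h := (abs_le.1 hX).2
  have h0 := abs_nonneg X
  linarith

/-- The bookkeeping of the cross bound: `18 (C (s/(c₀/2))⁴)² (K₁W4⁴/s³)(K₀W4⁴/s⁴) = [18 C² (2/c₀)⁸ K₁K₀ 4⁸ W²]·s`. [folklore] -/
theorem cross_arith {C c₀ K₁ K₀ W s : ℝ} (hs : 0 < s) (hc₀ : 0 < c₀) :
    18 * (C * (s / (c₀ / 2)) ^ 4) ^ 2 * (K₁ * W * 4 ^ 4 / s ^ 3) * (K₀ * W * 4 ^ 4 / s ^ 4) =
      (18 * C ^ 2 * (2 / c₀) ^ 8 * K₁ * K₀ * 4 ^ 8 * W ^ 2) * s := by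
  have hs0 : s ≠ 0 := hs.ne'
  have hc0 : c₀ ≠ 0 := hc₀.ne'
  field_simp

/-- `M · (ε/(M+1)) ≤ ε` for `M ≥ 0`, `ε > 0`. [folklore] -/
theorem mul_div_succ_le {M ε : ℝ} (hM : 0 ≤ M) (hε : 0 < ε) : M * (ε / (M + 1)) ≤ ε := by
  rw [mul_div_assoc', div_le_iff₀ (by positivity)]
  nlinarith

/-! ## §3 `CollarBumpFloors` -/

set_option maxHeartbeats 400000 in
/-- **`CollarBumpFloors`** (item stmt-QuantumFields-23680, LINE χ₂ «femto currency»), BY NAME: in any unit with `a → 0`,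
`FBL6 ∧ FC2 ⇒` the femto-window reflection floors of `FemtoFloorUnit` for bumps of every radius.  Proof: `Qrp(f) = Q2(θf, f) −
Cov_P(D_f ∘ refl, B_f)` (landed `ThermalDescent.TransportIdentity`); `Q2(θf, f) ≥ 3ε` uniformly over the femto window
(`twoPoint_floor_window`, from `FBL ⇐ FBL6` and `FC2`); the electric cross term is `≤ 18(C/R⁴)²·Σ|df|·Σ|f| = O(a) ≤ ε`
(`abs_cross_le` with `MomentBounds6 ⇐ FBL6` by the landed `stub_collar6`, translate-uniform Schwartz weight sums). [folklore] -/
theorem collarBumpFloors_proof : Summit.QuantumFields.YangMills.Theses.SqueezedSkewness.CollarBumpFloors := by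
  intro G _ _ _ _ hG r a ha ha0 hFBL6 hFC2
  letI : MeasurableSpace G := borel G
  haveI : BorelSpace G := ⟨rfl⟩
  haveI : SecondCountableTopology G :=
    (r.continuous.isClosedEmbedding r.injective).isEmbedding.secondCountableTopology
  dsimp only
  intro ρ hρ
  -- the windowed two-point floor (FBL ⇐ FBL6, FC2)
  obtain ⟨v, hv0, hvball, δ₁, δ₂, h₁, ε, β₅, Λ₅, hδ₁, hvslab, hh₁, h3h₁, hε, hfloor⟩ :=
    twoPoint_floor_window G r a ha ha0 (fbl_of_fbl6 r a hFBL6) hFC2 ρ hρ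
  -- the collar output and the decay constants of the bump
  obtain ⟨C, β₄, ℓ₄, hℓ₄, hC0, hMB⟩ :=
    Summit.QuantumFields.YangMills.Cruxes.OSLegsFromFemtoAndGap.DlrCollarTransfer.stub_collar6 G r a hFBL6
  obtain ⟨K₀, hK₀0, hK₀⟩ := exists_abs_le_decay v
  obtain ⟨K₁, hK₁0, hK₁⟩ := exists_abs_sub_le_decay v
  -- constants
  obtain ⟨c₀, hc₀⟩ : ∃ c₀ : ℝ, c₀ = min (h₁ / 4) ℓ₄ := ⟨_, rfl⟩
  have hc₀0 : 0 < c₀ := by rw [hc₀]; exact lt_min (by positivity) hℓ₄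
  have hc₀h : c₀ ≤ h₁ / 4 := by rw [hc₀]; exact min_le_left _ _
  have hc₀ℓ : c₀ ≤ ℓ₄ := by rw [hc₀]; exact min_le_right _ _
  obtain ⟨T₀, hT₀⟩ : ∃ T₀ : ℝ, T₀ = |δ₁| + 3 * h₁ := ⟨_, rfl⟩
  have hT₀0 : 0 ≤ T₀ := by rw [hT₀]; positivity
  obtain ⟨Mx, hMx⟩ : ∃ Mx : ℝ, Mx = 18 * C ^ 2 * (2 / c₀) ^ 8 * K₁ * K₀ * 4 ^ 8 * ((1 + T₀) ^ 8) ^ 2 := ⟨_, rfl⟩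
  have hMx0 : 0 ≤ Mx := by rw [hMx]; positivity
  obtain ⟨βa, hβa⟩ := eventually_le_of_tendsto ha0 (δ := min (min (c₀ / 2) (h₁ / 4)) (min 1 (ε / (Mx + 1))))
    (lt_min (lt_min (by positivity) (by positivity)) (lt_min one_pos (by positivity)))
  refine ⟨v, hv0, hvball, δ₁, δ₂, h₁, ε, max (max β₅ β₄) (max βa 0),
    max Λ₅ (max (4 * c₀ + 8) (2 * (|δ₂| + T₀) + 1)), hδ₁, hvslab, hh₁, h3h₁, hε, ?_⟩
  intro β hβ L hL τ f hτ1 hτ2 hf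
  -- thresholds
  have hβ₅ : β₅ ≤ β := le_trans (le_max_left _ _) (le_trans (le_max_left _ _) hβ)
  have hβ₄ : β₄ ≤ β := le_trans (le_max_right _ _) (le_trans (le_max_left _ _) hβ)
  have hβa' : βa ≤ β := le_trans (le_max_left _ _) (le_trans (le_max_right _ _) hβ)
  have hβ0 : 0 ≤ β := le_trans (le_max_right _ _) (le_trans (le_max_right _ _) hβ)
  have hs : 0 < a β := ha β
  have hsa := hβa β hβa'
  have hsc : a β ≤ c₀ / 2 := hsa.trans ((min_le_left _ _).trans (min_le_left _ _))
  have hsh : a β ≤ h₁ / 4 := hsa.trans ((min_le_left _ _).trans (min_le_right _ _))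
  have hs1 : a β ≤ 1 := hsa.trans ((min_le_right _ _).trans (min_le_left _ _))
  have hsε : a β ≤ ε / (Mx + 1) := hsa.trans ((min_le_right _ _).trans (min_le_right _ _))
  have hLΛ : Λ₅ ≤ a β * L := (le_max_left _ _).trans hL
  have hLc : 4 * c₀ + 8 ≤ a β * L := (le_max_left _ _).trans ((le_max_right _ _).trans hL)
  have hLδ : 2 * (|δ₂| + T₀) + 1 ≤ a β * L := (le_max_right _ _).trans ((le_max_right _ _).trans hL)
  have hL1 : 1 ≤ L := by
    rcases Nat.eq_zero_or_pos L with h | h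
    · exfalso
      rw [h, Nat.cast_zero, mul_zero] at hLc
      linarith
    · exact h
  -- the window of this translate
  have hτabs : |τ| ≤ T₀ := by
    rw [hT₀, abs_le]
    constructor
    · linarith [le_abs_self δ₁]
    · linarith [le_abs_self δ₁]
  have hw : ‖τ • EuclideanSpace.single (0 : Fin 4) (1 : ℝ)‖ ≤ T₀ := by
    rw [norm_smul, PiLp.norm_single, norm_one, mul_one, Real.norm_eq_abs]; exact hτabs
  have hδ₁τ : 0 < δ₁ - τ := by linarith
  have hfslab : tsupport (f : EuclideanSpace ℝ (Fin 4) → ℝ) ⊆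
      {y : EuclideanSpace ℝ (Fin 4) | δ₁ - τ < y 0 ∧ y 0 < δ₂ - τ} := by
    intro y hy
    have h := hvslab (tsupport_translate_subset hf hy)
    simp only [Set.mem_setOf_eq, PiLp.add_apply, PiLp.smul_apply, PiLp.single_apply, if_true, smul_eq_mul,
      mul_one] at h
    constructor <;> linarith [h.1, h.2]
  have hδ₂' : |δ₂ - τ| ≤ |δ₂| + T₀ := (abs_sub _ _).trans (by linarith)
  have hLsep : 2 * |δ₂ - τ| + 1 ≤ a β * L := by linarith
  have hLTI : δ₂ - τ + a β ≤ a β * L := by linarith [le_abs_self (δ₂ - τ)]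
  -- the collar radius and the `n = 2` collar output
  obtain ⟨R, hRdef⟩ : ∃ R : ℕ, R = ⌊c₀ / a β⌋₊ := ⟨_, rfl⟩
  have hRle : (R : ℝ) ≤ c₀ / a β := by rw [hRdef]; exact Nat.floor_le (by positivity)
  have hRlt : c₀ / a β < R + 1 := by rw [hRdef]; exact Nat.lt_floor_add_one _
  have hc2 : 2 ≤ c₀ / a β := by rw [le_div_iff₀ hs]; linarith
  have hR1 : 1 ≤ R := by exact_mod_cast (show (1 : ℝ) ≤ R by linarith)
  have hRc : (R : ℝ) * a β ≤ c₀ := by rwa [le_div_iff₀ hs] at hRle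
  have hRs : (R : ℝ) * a β ≤ ℓ₄ := hRc.trans hc₀ℓ
  have hRL : 4 * R + 8 ≤ L := by
    have h1 : ((4 * R + 8 : ℕ) : ℝ) * a β ≤ (L : ℝ) * a β := by
      push_cast
      have : 4 * ((R : ℝ) * a β) + 8 * a β ≤ a β * L := by linarith
      linarith
    exact_mod_cast le_of_mul_le_mul_right h1 hs
  have hRsep : (2 * R + 4 : ℝ) ≤ 2 * (δ₁ - τ - a β) / a β := by
    rw [le_div_iff₀ hs]
    have h4 : 4 * a β ≤ δ₁ - τ := by linarith
    have h5 : 2 * ((R : ℝ) * a β) ≤ 2 * c₀ := by linarith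
    nlinarith
  have hRhalf : c₀ / 2 / a β ≤ R := by
    rw [div_div, show c₀ / (2 * a β) = c₀ / a β / 2 by rw [div_div, mul_comm]]; linarith
  have H : ∀ (n : ℕ) (q : Fin n → Fin 4 × Fin 4) (x : Fin n → (Fin 4 → ℤ)), (∀ i, (q i).1 < (q i).2) →
      (∀ i j : Fin n, i ≠ j → ∃ k : Fin 4,
        (2 * (R : ℤ) + 4) ≤ |((((x i k - x j k : ℤ) : ZMod (2 * L + 1))).valMinAbs : ℤ)|) →
      |torusE G r β L (fun U => ∏ i, (plane G r (q i) (x i) U - torusE G r β L (plane G r (q i) (x i))))| ≤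
        (C / (R : ℝ) ^ 4) ^ n :=
    fun n q x hq hsep => hMB β hβ₄ L n q x R hq hR1 hRs hRL hsep
  -- smallness of the cross term
  obtain ⟨W, hW⟩ : ∃ W : ℝ, W = (1 + ‖τ • EuclideanSpace.single (0 : Fin 4) (1 : ℝ)‖) ^ 8 := ⟨_, rfl⟩
  have hW0 : 0 ≤ W := by rw [hW]; positivity
  have hWT : W ≤ (1 + T₀) ^ 8 := by rw [hW]; exact pow_le_pow_left₀ (by positivity) (by linarith) 8
  have hCR : C / (R : ℝ) ^ 4 ≤ C * (a β / (c₀ / 2)) ^ 4 := div_pow_depth_le hC0 (by positivity) hs hRhalf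
  have hsmall : 18 * (C / (R : ℝ) ^ 4) ^ 2 * (K₁ * W * 4 ^ 4 / a β ^ 3) * (K₀ * W * 4 ^ 4 / a β ^ 4) ≤ ε := by
    have h1 : (C / (R : ℝ) ^ 4) ^ 2 ≤ (C * (a β / (c₀ / 2)) ^ 4) ^ 2 := pow_le_pow_left₀ (by positivity) hCR 2
    have h2 : 18 * (C * (a β / (c₀ / 2)) ^ 4) ^ 2 * (K₁ * W * 4 ^ 4 / a β ^ 3) * (K₀ * W * 4 ^ 4 / a β ^ 4) =
        (18 * C ^ 2 * (2 / c₀) ^ 8 * K₁ * K₀ * 4 ^ 8 * W ^ 2) * a β := cross_arith hs hc₀0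
    have h3 : 18 * C ^ 2 * (2 / c₀) ^ 8 * K₁ * K₀ * 4 ^ 8 * W ^ 2 ≤ Mx := by
      rw [hMx]
      have : W ^ 2 ≤ ((1 + T₀) ^ 8) ^ 2 := pow_le_pow_left₀ hW0 hWT 2
      exact mul_le_mul_of_nonneg_left this (by positivity)
    have h4 : Mx * (ε / (Mx + 1)) ≤ ε := mul_div_succ_le hMx0 hε
    have hB1 : 0 ≤ K₁ * W * 4 ^ 4 / a β ^ 3 := by positivity
    have hB2 : 0 ≤ K₀ * W * 4 ^ 4 / a β ^ 4 := by positivity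
    calc 18 * (C / (R : ℝ) ^ 4) ^ 2 * (K₁ * W * 4 ^ 4 / a β ^ 3) * (K₀ * W * 4 ^ 4 / a β ^ 4)
        ≤ 18 * (C * (a β / (c₀ / 2)) ^ 4) ^ 2 * (K₁ * W * 4 ^ 4 / a β ^ 3) * (K₀ * W * 4 ^ 4 / a β ^ 4) :=
          mul_le_mul_of_nonneg_right (mul_le_mul_of_nonneg_right
            (mul_le_mul_of_nonneg_left h1 (by norm_num)) hB1) hB2
      _ = (18 * C ^ 2 * (2 / c₀) ^ 8 * K₁ * K₀ * 4 ^ 8 * W ^ 2) * a β := h2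
      _ ≤ Mx * a β := mul_le_mul_of_nonneg_right h3 hs.le
      _ ≤ Mx * (ε / (Mx + 1)) := mul_le_mul_of_nonneg_left hsε hMx0
      _ ≤ ε := h4
  -- the weight sums of the translate
  have hSd : ∑ x : FinTorusSite (2 * L + 1) (2 * L + 1) (2 * L + 1) (2 * L + 1),
      |f (a β • posZ (2 * L + 1) x + a β • EuclideanSpace.single (0 : Fin 4) (1 : ℝ)) - f (a β • posZ (2 * L + 1) x)| ≤
      K₁ * W * 4 ^ 4 / a β ^ 3 := by
    have e : ∀ x : FinTorusSite (2 * L + 1) (2 * L + 1) (2 * L + 1) (2 * L + 1),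
        |f (a β • posZ (2 * L + 1) x + a β • EuclideanSpace.single (0 : Fin 4) (1 : ℝ)) - f (a β • posZ (2 * L + 1) x)| =
        |v (a β • posZ (2 * L + 1) x + a β • EuclideanSpace.single (0 : Fin 4) (1 : ℝ) +
            τ • EuclideanSpace.single (0 : Fin 4) (1 : ℝ)) -
          v (a β • posZ (2 * L + 1) x + τ • EuclideanSpace.single (0 : Fin 4) (1 : ℝ))| := fun x => by
      rw [hf, hf]
    rw [Finset.sum_congr rfl (fun x _ => e x), hW]
    exact sum_abs_sub_translate_le hK₁0 hK₁ L hs hs1 _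
  have hSc : ∑ y : FinTorusSite (2 * L + 1) (2 * L + 1) (2 * L + 1) (2 * L + 1), |f (a β • posZ (2 * L + 1) y)| ≤
      K₀ * W * 4 ^ 4 / a β ^ 4 := by
    have e : ∀ y : FinTorusSite (2 * L + 1) (2 * L + 1) (2 * L + 1) (2 * L + 1),
        |f (a β • posZ (2 * L + 1) y)| =
        |v (a β • siteToE (zOf (2 * L + 1) y) + τ • EuclideanSpace.single (0 : Fin 4) (1 : ℝ))| := fun y => by
      rw [hf, posZ_eq_siteToE_zOf]
    rw [Finset.sum_congr rfl (fun y _ => e y), hW]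
    exact sum_abs_translate_le hK₀0 hK₀ L hs hs1 _
  -- (1) the two-point floor, (2) the cross term, (3) the transport identity
  have hQ2 : 3 * ε ≤ Q2 G r β L (a β) (thetaTest 4 f) f := hfloor β hβ₅ L hLΛ τ f hτ1 hτ2 hf
  have hcross := abs_cross_le G r β L H hs hs1 f hfslab hLsep hRsep hSd hSc
  have hTI := Summit.QuantumFields.YangMills.Theorems.ThermalDescentTransportIdentity.thermalDescent_transportIdentity G hG r
  dsimp only at hTI
  exact le_of_split (hTI β L (a β) f (δ₁ - τ) (δ₂ - τ) hβ0 hL1 hs hδ₁τ hfslab hLTI) hQ2 (hcross.trans hsmall)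

end Summit.QuantumFields.YangMills.Theorems.CollarBumpFloorsProof

end
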